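import Literature.AlgebraicGeometry.RealAlgebraic.RealAlgebraicCoordinates
import Literature.AlgebraicGeometry.RealAlgebraic.SubmanifoldTangent
import HarnessLib

/-!
# Morphisms of schemes on real points: smooth ambient extensions, semialgebraic graphs

Let `k ⊆ ℝ` be a field, `X`, `Y` two `k`-schemes with algebraic coordinate systems
`f₁, …, f_N ∈ Γ(X, V)` and `f'₁, …, f'_{N'} ∈ Γ(Y, V')` on their real points
(`Literature.AlgebraicGeometry.RealAlgebraic.IsAlgCoordSystem`, file
`RealAlgebraic/RealAlgebraicCoordinates`), `X` proper, and `φ : X → Y` a `k`-morphism. In the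
coordinates, `φ` becomes the map `f(P) ↦ f'(φ P)` of the compact set `f(X(ℝ)) ⊆ ℝ^N` into
`ℝ^{N'}`. This file proves (`IsAlgCoordSystem.exists_contDiff_map`) that this map is

* the restriction of a **`C^∞` map of the ambient spaces** `F : ℝ^N → ℝ^{N'}`, and
* a **`k`-semialgebraic map** on `f(X(ℝ))`,

as required of the group law, the inversion and the Abel–Jacobi map in
`RealAbelJacobi.CompactAbelianNashGroup` / `RealAbelJacobi` (file `RealAlgebraic/RealAbelJacobi`).
Proof: each coordinate `P ↦ f'_j(φ P) = (φ^* f'_j)(P)` is the value of the regular function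
`φ^* f'_j ∈ Γ(X, φ⁻¹V')` (all real points lie in `φ⁻¹V'`), hence (file `RealAlgebraicCoordinates`)
a `k`-semialgebraic function of the coordinates on `f(X(ℝ))`
(`IsAlgCoordSystem.exists_isSemialgebraicFunOn_eval`; BCR Prop. 2.2.7/Def. 2.2.5: regular maps are
semialgebraic) which is, near every point of `f(X(ℝ))`, the restriction of a real-analytic function
on an open subset of `ℝ^N` (`IsAlgCoordSystem.exists_analyticOnNhd_eval`: locally a quotient of
polynomials with non-vanishing denominator). Local smooth representatives agreeing on the closed set
`f(X(ℝ))` glue to a global `C^∞` function by a smooth partition of unity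
(`exists_contDiff_of_local` of `RealAlgebraic/SubmanifoldTangent`, from Mathlib's
`exists_contMDiffMap_forall_mem_convex_of_local`; Lee, *Introduction to Smooth Manifolds*,
Lemma 2.26), and semialgebraicity only depends on the values on
`f(X(ℝ))`. No named fact is introduced.

## References

* J. Bochnak, M. Coste, M.-F. Roy, *Real Algebraic Geometry* (1998), Def. 2.2.5, Prop. 2.2.7.
  [BochnakCosteRoy1998]
* J. M. Lee, *Introduction to Smooth Manifolds*, 2nd ed. (2013), Lemma 2.26 (extension lemma for
  smooth functions on closed sets). [LeeSmoothManifolds2013]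
-/

noncomputable section

open CategoryTheory AlgebraicGeometry Set Filter
open _root_.Topology
open scoped ContDiff Manifold

namespace Literature.AlgebraicGeometry.RealAlgebraic

open Literature.AlgebraicGeometry.Motives Literature.NumberTheory.Transcendental
  Literature.ModelTheory.ExponentialFields

/-! ### Morphisms in coordinates -/

section Morphisms

variable {k : Type} [Field k] [Algebra k ℝ] {X Y : SchemeOver k} {N N' : ℕ}
  {V : X.left.Opens} {f : Fin N → Γ(X.left, V)} {V' : Y.left.Opens}
  {f' : Fin N' → Γ(Y.left, V')}

/-- **A `k`-morphism in algebraic coordinates is a smooth, semialgebraic map.** For algebraic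
coordinate systems `f` on `X(ℝ)` (`X` proper, Noetherian) and `f'` on `Y(ℝ)` and a `k`-morphism
`φ : X → Y`, there is a `C^∞` map `F : ℝ^N → ℝ^{N'}` with `F(f(P)) = f'(φ P)` for every real
point `P`, which is a `k`-semialgebraic map on `f(X(ℝ))` (regular maps are semialgebraic,
BCR Prop. 2.2.7; real-analytic local representatives glued by a partition of unity,
Lee Lemma 2.26). [cite: BochnakCosteRoy1998, Def. 2.2.5 and Prop. 2.2.7] -/
theorem IsAlgCoordSystem.exists_contDiff_map [TopologicalSpace.NoetherianSpace X.left]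
    [IsProper X.hom]
    (hcX : IsAlgCoordSystem ℝ V f) (hcY : IsAlgCoordSystem ℝ V' f') (φ : X ⟶ Y) :
    ∃ F : (Fin N → ℝ) → (Fin N' → ℝ), ContDiff ℝ ∞ F ∧
      (∀ P : AlgPoints X ℝ, F (coordMap ℝ V f P) = coordMap ℝ V' f' (AlgPoints.map φ P)) ∧
      IsSemialgebraicMapOn k (range (coordMap ℝ V f)) F := by
  -- every real point lies in `φ⁻¹V'`, where the pulled-back coordinates `φ^* f'_j` live
  have hUmem : ∀ P : AlgPoints X ℝ, P.pt ∈ φ.left ⁻¹ᵁ V' := fun P =>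
    hcY.pt_mem (AlgPoints.map φ P)
  have hs : ∀ (P : AlgPoints X ℝ) (j : Fin N'),
      P.eval (φ.left ⁻¹ᵁ V') (hUmem P) (φ.left.app V' (f' j)) =
        coordMap ℝ V' f' (AlgPoints.map φ P) j := by
    intro P j
    rw [coordMap_apply_of_mem (hcY.pt_mem _), AlgPoints.eval_map]
  have himg : coordMap ℝ V f '' {Q : AlgPoints X ℝ | Q.pt ∈ φ.left ⁻¹ᵁ V'} =
      range (coordMap ℝ V f) := by
    rw [show {Q : AlgPoints X ℝ | Q.pt ∈ φ.left ⁻¹ᵁ V'} = univ from eq_univ_of_forall hUmem,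
      image_univ]
  -- coordinate by coordinate
  have hcoord : ∀ j : Fin N', ∃ Fj : (Fin N → ℝ) → ℝ, ContDiff ℝ ∞ Fj ∧
      (∀ P : AlgPoints X ℝ, Fj (coordMap ℝ V f P) = coordMap ℝ V' f' (AlgPoints.map φ P) j) ∧
      IsSemialgebraicFunOn k (range (coordMap ℝ V f)) Fj := by
    intro j
    obtain ⟨T, hTsa, hT⟩ := hcX.exists_isSemialgebraicFunOn_eval (φ.left.app V' (f' j))
    rw [himg] at hTsa
    have hloc : ∀ x ∈ range (coordMap ℝ V f), ∃ O ∈ 𝓝 x, ∃ G : (Fin N → ℝ) → ℝ,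
        ContDiffOn ℝ ∞ G O ∧ ∀ y ∈ range (coordMap ℝ V f) ∩ O, G y = T y := by
      rintro _ ⟨P, rfl⟩
      obtain ⟨O, G, hOo, -, hPO, hGan, hGval⟩ :=
        hcX.exists_analyticOnNhd_eval (φ.left.app V' (f' j)) (hUmem P)
      refine ⟨O, hOo.mem_nhds hPO, G, hGan.contDiffOn_of_completeSpace, ?_⟩
      rintro _ ⟨⟨Q, rfl⟩, hQO⟩
      obtain ⟨hQ, hQval⟩ := hGval Q hQO
      rw [← hQval, hT Q hQ]
    obtain ⟨Fj, hFj, hFjT⟩ := exists_contDiff_of_local hcX.isCompact_range.isClosed T hloc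
    refine ⟨Fj, hFj, fun P => ?_, hTsa.congr fun y hy => (hFjT y hy).symm⟩
    rw [hFjT _ (mem_range_self P), hT P (hUmem P), hs]
  choose Fc hFc hFcval hFcsa using hcoord
  exact ⟨fun v j => Fc j v, contDiff_pi.mpr hFc, fun P => funext fun j => hFcval j P,
    IsSemialgebraicMapOn.of_forall hcX.isSemialgebraic_range hFcsa⟩

end Morphisms

end Literature.AlgebraicGeometry.RealAlgebraic

end
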